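import Summits.KontsevichZagierPeriods.KontsevichZagierPeriods.Theses.HurwitzMicroSectors
import Summits.KontsevichZagierPeriods.KontsevichZagierPeriods.Theorems.HurwitzMicroSectorsNormalFormPrinciplePiBoxTransfer
import Summits.KontsevichZagierPeriods.KontsevichZagierPeriods.Theorems.HurwitzMicroSectorsNormalFormPrincipleVariants2227

/-! TTRL-lite variant V2258 of stmt-KontsevichZagierPeriods-3869

Variant V2258 = `stub_boxRigidity` (the leaf `BoxRigidity` of `NormalFormPrinciple`: two representations
on open unit boxes with integrands of KZ's rational shape `p/q` over `ℚ` and equal values are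
KZ-equivalent) under the move `fix_nat:m=3; bound_nat:m'≤6` (left dimension frozen to `3`, right
dimension bounded by `6`). Verdict of the attempt seat: **open** — this file is the exact-strength
certificate, not a proof of the variant. For every `K` let `BoxVanishing K` say that a box-rational
representation of dimension `K` and value `0` is a relation.

* `stub_boxRigidity_var2258_iff_boxVanishing_six`: V2258 ⟺ **BoxVanishing 6** (⇒: the pair `(3, 6)` is
  allowed, compare a `6`-dimensional representation of value `0` with the zero representation on the
  `3`-box, `boxVanishingDim_right_of_pair`; ⇐: pad both representations to the `6`-box and subtract
  there, `boxRigidityLe_of_boxVanishingDim` — the frozen `3` is idle);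
* `stub_boxRigidity_var2258_iff_var2257` / `_iff_var2227`: V2258 is literally the siblings V2257
  (`(m, m') = (3, 6)`) and V2227 (`(2, 6)`);
* `stub_boxRigidity_var2258_iff_le_six`: V2258 ⟺ BoxRigidity for ALL `m, m' ≤ 6` — Conjecture 1 of
  Kontsevich–Zagier for every pair of rational integrands on the boxes `(0,1)^{≤6}`;
* `boxVanishing_le_six_of_stub_boxRigidity_var2258`: V2258 gives `BoxVanishing j` for every `j ≤ 6`, so
  it contains the square (`BoxVanishing 2`: for `a b : ℚ`, "`a + b·G = 0 ⇒ [a + b/(1+x²y²)]_{(0,1)²}` is a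
  relation", `G` Catalan's constant — provable today only through the irrationality of `G` (open) or an
  explicit chain of moves, none known) and dimension `5` (the same dichotomy for
  `ζ(5) = ∫_{(0,1)⁵} dx/(1 − x₁⋯x₅)`). This is the residual goal; `BoxVanishing 1` is the tree's theorem
  `boxRigidity_of_le_one` (Baker), dimension `2` is the first open rung;
* `stub_boxRigidity_var2258_of_parent` / `_of_statement`: parent leaf ⇒ V2258 and
  `KontsevichZagierPeriods ⇒ V2258`, so a refutation of the variant would refute Conjecture 1 for the
  tree's calculus — the variant is neither provable nor refutable from the tree today.

Source: M. Kontsevich, D. Zagier, *Periods* (2001), §1.2 Conjecture 1. Pure proof file, no definitions. -/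

-- `Summit.<Summit>.<Problem>` is the tree's mandated summit-side namespace (CONVENTIONS §2); for this
-- single-conjunct summit the two coincide, so the duplicate is deliberate.
set_option linter.dupNamespace false

noncomputable section

namespace Summit.KontsevichZagierPeriods.KontsevichZagierPeriods.Theorems

open MeasureTheory Set
open Literature.NumberTheory.Transcendental Literature.NumberTheory.Transcendental.KZ
open Summit.KontsevichZagierPeriods.KontsevichZagierPeriods.Theses.HurwitzMicroSectors
open Summit.KontsevichZagierPeriods.HurwitzMicroSectors.NormalFormPrinciple.PiBox

/-! ## The variant V2258 itself: exactly `BoxVanishing 6` -/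

/-- **V2258 ⟺ `BoxVanishing 6`**: (⇒) the pair `(3, 6)` is allowed (`6 ≤ 6`), so
`boxVanishingDim_right_of_pair 3 6`; (⇐) `boxRigidityLe_of_boxVanishingDim 6` with `m = 3 ≤ 6`, `m' ≤ 6`.
[cite: KontsevichZagier2001, §1.2 Conjecture 1] -/
theorem stub_boxRigidity_var2258_iff_boxVanishing_six :
    (∀ (m' : ℕ) (N : IntegralRep 3) (N' : IntegralRep m'), m' ≤ 6 → N.domain = {x | ∀ i, x i ∈ Set.Ioo (0:ℝ) 1} → N.IsRational → N'.domain = {x | ∀ i, x i ∈ Set.Ioo (0:ℝ) 1} → N'.IsRational → N.value = N'.value → Equivalent N N') ↔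
    (∀ (M : IntegralRep 6), M.domain = {x | ∀ i, x i ∈ Set.Ioo (0:ℝ) 1} → M.IsRational →
      M.value = 0 → of M ∈ relations) :=
  ⟨fun h => boxVanishingDim_right_of_pair 3 6 fun N N' => h 6 N N' le_rfl,
    fun hvan m' N N' hm' => boxRigidityLe_of_boxVanishingDim 6 hvan 3 m' N N' (by norm_num) hm'⟩

/-- **V2258 ⟺ the sibling V2257** (`fix_nat:m=3; fix_nat:m'=6`): both are `BoxVanishing 6`, the bound
`m' ≤ 6` is already attained at `m' = 6`. [cite: KontsevichZagier2001, §1.2 Conjecture 1] -/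
theorem stub_boxRigidity_var2258_iff_var2257 :
    (∀ (m' : ℕ) (N : IntegralRep 3) (N' : IntegralRep m'), m' ≤ 6 → N.domain = {x | ∀ i, x i ∈ Set.Ioo (0:ℝ) 1} → N.IsRational → N'.domain = {x | ∀ i, x i ∈ Set.Ioo (0:ℝ) 1} → N'.IsRational → N.value = N'.value → Equivalent N N') ↔
    (∀ (N : IntegralRep 3) (N' : IntegralRep 6), N.domain = {x | ∀ i, x i ∈ Set.Ioo (0:ℝ) 1} → N.IsRational → N'.domain = {x | ∀ i, x i ∈ Set.Ioo (0:ℝ) 1} → N'.IsRational → N.value = N'.value → Equivalent N N') := by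
  rw [stub_boxRigidity_var2258_iff_boxVanishing_six]
  exact (boxRigidityPair_iff_boxVanishingDim_right (by norm_num)).symm

/-- **V2258 ⟺ the sibling V2227** (`fix_nat:m=2; fix_nat:m'=6`): both are `BoxVanishing 6`, the frozen
left dimension is idle. [cite: KontsevichZagier2001, §1.2 Conjecture 1] -/
theorem stub_boxRigidity_var2258_iff_var2227 :
    (∀ (m' : ℕ) (N : IntegralRep 3) (N' : IntegralRep m'), m' ≤ 6 → N.domain = {x | ∀ i, x i ∈ Set.Ioo (0:ℝ) 1} → N.IsRational → N'.domain = {x | ∀ i, x i ∈ Set.Ioo (0:ℝ) 1} → N'.IsRational → N.value = N'.value → Equivalent N N') ↔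
    (∀ (N : IntegralRep 2) (N' : IntegralRep 6), N.domain = {x | ∀ i, x i ∈ Set.Ioo (0:ℝ) 1} → N.IsRational → N'.domain = {x | ∀ i, x i ∈ Set.Ioo (0:ℝ) 1} → N'.IsRational → N.value = N'.value → Equivalent N N') := by
  rw [stub_boxRigidity_var2258_iff_boxVanishing_six, stub_boxRigidity_var2227_iff_boxVanishing_six]

/-- **V2258 ⟺ `BoxRigidity` for all `m, m' ≤ 6`** (the honest strength of the variant: Conjecture 1 for
all pairs of rational integrands on the open unit boxes of dimension at most `6`; so V2258 coincides with
the two-sided variants `bound_nat:m≤6; bound_nat:m'≤6` and `fix_nat:m=j; fix_nat:m'=k` for every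
`max j k = 6`). [cite: KontsevichZagier2001, §1.2 Conjecture 1] -/
theorem stub_boxRigidity_var2258_iff_le_six :
    (∀ (m' : ℕ) (N : IntegralRep 3) (N' : IntegralRep m'), m' ≤ 6 → N.domain = {x | ∀ i, x i ∈ Set.Ioo (0:ℝ) 1} → N.IsRational → N'.domain = {x | ∀ i, x i ∈ Set.Ioo (0:ℝ) 1} → N'.IsRational → N.value = N'.value → Equivalent N N') ↔
    (∀ (m m' : ℕ) (N : IntegralRep m) (N' : IntegralRep m'), m ≤ 6 → m' ≤ 6 →
      N.domain = {x | ∀ i, x i ∈ Set.Ioo (0:ℝ) 1} → N.IsRational →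
      N'.domain = {x | ∀ i, x i ∈ Set.Ioo (0:ℝ) 1} → N'.IsRational →
      N.value = N'.value → Equivalent N N') := by
  rw [stub_boxRigidity_var2258_iff_var2227]
  exact stub_boxRigidity_var2227_iff_le_six

/-- **V2258 ⇒ `BoxVanishing` in every dimension `≤ 6`** (monotonicity by padding), in particular the
square, which contains Catalan's dichotomy, and dimension `5`, which contains `ζ(5)`'s.
[cite: KontsevichZagier2001, §1.2 Conjecture 1] -/
theorem boxVanishing_le_six_of_stub_boxRigidity_var2258
    (h : ∀ (m' : ℕ) (N : IntegralRep 3) (N' : IntegralRep m'), m' ≤ 6 → N.domain = {x | ∀ i, x i ∈ Set.Ioo (0:ℝ) 1} → N.IsRational → N'.domain = {x | ∀ i, x i ∈ Set.Ioo (0:ℝ) 1} → N'.IsRational → N.value = N'.value → Equivalent N N')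
    {j : ℕ} (hj : j ≤ 6) (N : IntegralRep j) (hNd : N.domain = {x | ∀ i, x i ∈ Set.Ioo (0:ℝ) 1})
    (hNr : N.IsRational) (hv : N.value = 0) : of N ∈ relations :=
  boxVanishingDim_mono hj (stub_boxRigidity_var2258_iff_boxVanishing_six.1 h) N hNd hNr hv

/-! ## V2258 follows from the parent leaf and from the Summit -/

/-- **The parent leaf ⇒ V2258** (specialisation `m := 3`, the bound `m' ≤ 6` discarded; the converse is
not claimed — the parent is `BoxVanishing` in ALL dimensions). [cite: KontsevichZagier2001, §1.2 Conjecture 1] -/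
theorem stub_boxRigidity_var2258_of_parent
    (h : ∀ (m m' : ℕ) (N : IntegralRep m) (N' : IntegralRep m'), N.domain = {x | ∀ i, x i ∈ Set.Ioo (0:ℝ) 1} → N.IsRational → N'.domain = {x | ∀ i, x i ∈ Set.Ioo (0:ℝ) 1} → N'.IsRational → N.value = N'.value → Equivalent N N') :
    ∀ (m' : ℕ) (N : IntegralRep 3) (N' : IntegralRep m'), m' ≤ 6 → N.domain = {x | ∀ i, x i ∈ Set.Ioo (0:ℝ) 1} → N.IsRational → N'.domain = {x | ∀ i, x i ∈ Set.Ioo (0:ℝ) 1} → N'.IsRational → N.value = N'.value → Equivalent N N' :=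
  fun m' N N' _ => h 3 m' N N'

/-- **`KontsevichZagierPeriods ⇒ V2258`**: the variant is a special case of Conjecture 1 for the tree's
calculus (`leaves_of_statement`) — so a refutation of the variant would refute the Summit.
[cite: KontsevichZagier2001, §1.2 Conjecture 1] -/
theorem stub_boxRigidity_var2258_of_statement (h : _root_.KontsevichZagierPeriods) :
    ∀ (m' : ℕ) (N : IntegralRep 3) (N' : IntegralRep m'), m' ≤ 6 → N.domain = {x | ∀ i, x i ∈ Set.Ioo (0:ℝ) 1} → N.IsRational → N'.domain = {x | ∀ i, x i ∈ Set.Ioo (0:ℝ) 1} → N'.IsRational → N.value = N'.value → Equivalent N N' :=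
  stub_boxRigidity_var2258_of_parent (leaves_of_statement h).1

/-- **V2258 ⇒ the sibling V2238** (`fix_nat:m=3; bound_nat:m'≤2`, i.e. `BoxVanishing 3`): the
`(3, ≤ k)` variants are linearly ordered by the bound `k` (shrink the bound `2 ≤ 6`).
[cite: KontsevichZagier2001, §1.2 Conjecture 1] -/
theorem stub_boxRigidity_var2238_of_var2258
    (h : ∀ (m' : ℕ) (N : IntegralRep 3) (N' : IntegralRep m'), m' ≤ 6 → N.domain = {x | ∀ i, x i ∈ Set.Ioo (0:ℝ) 1} → N.IsRational → N'.domain = {x | ∀ i, x i ∈ Set.Ioo (0:ℝ) 1} → N'.IsRational → N.value = N'.value → Equivalent N N') :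
    ∀ (m' : ℕ) (N : IntegralRep 3) (N' : IntegralRep m'), m' ≤ 2 → N.domain = {x | ∀ i, x i ∈ Set.Ioo (0:ℝ) 1} → N.IsRational → N'.domain = {x | ∀ i, x i ∈ Set.Ioo (0:ℝ) 1} → N'.IsRational → N.value = N'.value → Equivalent N N' :=
  fun m' N N' hm' => h m' N N' (hm'.trans (by norm_num))

end Summit.KontsevichZagierPeriods.KontsevichZagierPeriods.Theorems

end
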